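import Summits.Schanuel.Schanuel.Theorems.DiophantineDichotomyApproximationPropertyIdegLeMulOfRankTwo
import Summits.Schanuel.Schanuel.Theorems.DiophantineDichotomyApproximationPropertyIdegLeMulOfRankOne
import HarnessLib

/-!
# The `Q₂`-normal form of the mid-low-small configuration (stub `midLowSmall3_normalForm`)

Crux `stmt-Schanuel-6117` (`Summit.Schanuel.Schanuel.Theses.DiophantineDichotomy.ApproximationProperty`),
line `orbit-interpolation-determinant`, lead c14 (`prover-line-stmt-Schanuel-6117-c14-0`), registered
support stub `midLowSmall3_normalForm` of skeleton v28 (`Cruxes/ApproximationProperty/Lines/orbit_interpolation_determinant.lean`;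
KERNEL-c13.md §2(i)(ii) made formal). The hypothesis `P ∈ 𝔮'` is load-bearing: without it conclusion
(1) fails (take `Q = Q₂ = x₀`, `P = x₁`, `𝔮 = (x₀, x₁)`, `𝔭 = (x₀, x₁, x₂)`, `𝔮' = (x₀, x₁³ − x₂² x₃)`
of degree `3 > 2Δa₂ = 2` at `Δ = M₁ = 1`).

In the bad configuration of the elimination descent in `ℙ³` over `ℚ` — cut-1 prime surface form `Q`
(degree `a ≤ Δ`, `(Q)` prime), cut-2 form `P ∉ (Q)` (degree `b ≤ 2Δ`), the selected prime curve
`𝔮 ∋ Q, P` (rank `2`), the bad orbit `𝔭 ⊇ 𝔮` (rank `1`, `D = ideg 𝔭 1` points), a satellite curve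
`𝔮' ∋ Q, P` with `𝔮' ⊆ 𝔭`, and a non-zero form `Q₂ ∈ 𝔮'` of low degree `a₂ ≤ d ≤ Δ/M₁` — one has
(1) `deg 𝔮' ≤ 2Δ·a₂`; (2) `Q₂ ∈ (Q) → a ≤ Δ/M₁`;
(3) `(Q₂ ∈ 𝔮 ∧ deg 𝔮 ≤ 2Δ·a₂) ∨ (Q₂ ∉ 𝔮 ∧ D ≤ deg 𝔮 · a₂)`.

Proof. If `Q ∣ Q₂` then `a ≤ a₂` (total degrees in the domain `ℚ[x̲]`), so (2) holds, `Q₂ ∈ 𝔮`,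
and BÉZOUT for the pair `(Q, P)` (`ideg_le_mul_of_rankTwo`) bounds `deg 𝔮'` and `deg 𝔮` by
`a b ≤ a₂ · 2Δ`. If `Q₂ ∉ (Q)` then (2) is vacuous, BÉZOUT for the pair `(Q, Q₂)` bounds `deg 𝔮'`
(and `deg 𝔮` when `Q₂ ∈ 𝔮`) by `a a₂ ≤ Δ a₂`, and when `Q₂ ∉ 𝔮` BÉZOUT on the curve `𝔮` cut by `Q₂`
(`ideg_le_mul_of_rankOne`, `Q₂ ∈ 𝔮' ⊆ 𝔭`) gives `D ≤ deg 𝔮 · a₂`.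

Proofs only (no definitions, no named facts). Sources: Nesterenko–Philippon (eds.), LNM 1752 (2001),
Ch. 3 §4 [cite: NesterenkoPhilippon2001, Ch. 3 Prop. 4.7 1), Prop. 4.8 1), Prop. 4.11 (pp. 39–41)].
-/

set_option linter.dupNamespace false

noncomputable section

attribute [local instance] MvPolynomial.gradedAlgebra

namespace Summit.Schanuel.Schanuel.Cruxes.ApproximationProperty.OrbitInterpolationDeterminant

open Literature.NumberTheory.Transcendental.Nesterenko MvPolynomial
open scoped BigOperators

/-- **Stub `midLowSmall3_normalForm`, corrected signature** (crux `stmt-Schanuel-6117`, line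
`orbit-interpolation-determinant`, KERNEL-c13 §2(i)(ii)): the `Q₂`-normal form of the mid-low-small
configuration — with `Q` (degree `a ≤ Δ`, `(Q)` prime), `P ∉ (Q)` (degree `b ≤ 2Δ`), the rank-2
primes `𝔮, 𝔮' ∋ Q, P` inside the rank-1 prime `𝔭`, and a non-zero form `Q₂ ∈ 𝔮'` of degree
`a₂ ≤ d ≤ Δ/M₁`: (1) `ideg 𝔮' 2 ≤ 2Δ a₂`; (2) `Q₂ ∈ (Q) → a ≤ Δ/M₁`;
(3) `(Q₂ ∈ 𝔮 ∧ ideg 𝔮 2 ≤ 2Δ a₂) ∨ (Q₂ ∉ 𝔮 ∧ ideg 𝔭 1 ≤ ideg 𝔮 2 · a₂)`. The hypothesis `P ∈ 𝔮'`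
(absent from the v28 registration) is necessary for (1).
[cite: NesterenkoPhilippon2001, Ch. 3 Prop. 4.7 1), Prop. 4.8 1), Prop. 4.11 (pp. 39–41)] -/
theorem midLowSmall3_normalForm : ∀ (Δ M₁ : ℝ) (Q : Rx 3) (a : ℕ) (P : Rx 3) (b : ℕ) (𝔮 𝔭 𝔮' : Ideal (Rx 3)) (Q₂ : Rx 3) (a₂ d : ℕ), Q ≠ 0 → Q.IsHomogeneous a → 1 ≤ a → (a : ℝ) ≤ Δ → (Ideal.span {Q}).IsPrime → P.IsHomogeneous b → 1 ≤ b → (b : ℝ) ≤ 2 * Δ → P ∉ Ideal.span {Q} → 𝔮.IsPrime → 𝔮.IsHomogeneous (homogeneousSubmodule (Fin (3 + 1)) ℚ) → IsUnmixedOfRank 𝔮 2 → Q ∈ 𝔮 → P ∈ 𝔮 → 𝔭.IsPrime → 𝔭.IsHomogeneous (homogeneousSubmodule (Fin (3 + 1)) ℚ) → IsUnmixedOfRank 𝔭 1 → 𝔮 ≤ 𝔭 → 𝔮'.IsPrime → 𝔮'.IsHomogeneous (homogeneousSubmodule (Fin (3 + 1)) ℚ) → IsUnmixedOfRank 𝔮'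 2 → Q ∈ 𝔮' → P ∈ 𝔮' → 𝔮' ≤ 𝔭 → Q₂ ≠ 0 → Q₂.IsHomogeneous a₂ → 1 ≤ a₂ → a₂ ≤ d → (d : ℝ) ≤ Δ / M₁ → Q₂ ∈ 𝔮' → (ideg 𝔮' 2 : ℝ) ≤ 2 * Δ * a₂ ∧ (Q₂ ∈ Ideal.span {Q} → (a : ℝ) ≤ Δ / M₁) ∧ ((Q₂ ∈ 𝔮 ∧ (ideg 𝔮 2 : ℝ) ≤ 2 * Δ * a₂) ∨ (Q₂ ∉ 𝔮 ∧ ideg 𝔭 1 ≤ ideg 𝔮 2 * a₂)) := by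
  intro Δ M₁ Q a P b 𝔮 𝔭 𝔮' Q₂ a₂ d hQ0 hQhom ha1 haΔ hQprime hPhom hb1 hbΔ hPQ h𝔮p h𝔮h h𝔮u hQ𝔮
    hP𝔮 h𝔭p h𝔭h h𝔭u h𝔮𝔭 h𝔮'p h𝔮'h h𝔮'u hQ𝔮' hP𝔮' h𝔮'𝔭 hQ₂0 hQ₂hom ha₂1 ha₂d hdΔ hQ₂𝔮'
  have hΔ1 : (1 : ℝ) ≤ Δ := le_trans (by exact_mod_cast ha1) haΔ
  have ha₂dΔ : (a₂ : ℝ) ≤ Δ / M₁ := le_trans (by exact_mod_cast ha₂d) hdΔ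
  by_cases hQQ₂ : Q₂ ∈ Ideal.span {Q}
  · -- `Q ∣ Q₂`: `a ≤ a₂`, `Q₂ ∈ 𝔮`, and Bézout for the pair `(Q, P)` on `𝔮'` and on `𝔮`
    have hdvd : Q ∣ Q₂ := Ideal.mem_span_singleton.mp hQQ₂
    have haa₂ : a ≤ a₂ := by
      have h := totalDegree_le_of_dvd_of_isDomain hdvd hQ₂0
      rwa [hQhom.totalDegree hQ0, hQ₂hom.totalDegree hQ₂0] at h
    have haa₂R : (a : ℝ) ≤ a₂ := by exact_mod_cast haa₂
    have hQ₂𝔮 : Q₂ ∈ 𝔮 := (Ideal.span_singleton_le_iff_mem 𝔮).mpr hQ𝔮 hQQ₂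
    have h1 : ideg 𝔮' 2 ≤ a * b :=
      ideg_le_mul_of_rankTwo Q P a b hQ0 hQhom hPhom ha1 hb1 hQprime hPQ 𝔮' h𝔮'p h𝔮'h h𝔮'u hQ𝔮'
        hP𝔮'
    have h3 : ideg 𝔮 2 ≤ a * b :=
      ideg_le_mul_of_rankTwo Q P a b hQ0 hQhom hPhom ha1 hb1 hQprime hPQ 𝔮 h𝔮p h𝔮h h𝔮u hQ𝔮 hP𝔮
    have hab : ((a * b : ℕ) : ℝ) ≤ 2 * Δ * a₂ := by
      push_cast
      calc (a : ℝ) * b ≤ a₂ * (2 * Δ) := mul_le_mul haa₂R hbΔ (by positivity) (by positivity)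
        _ = 2 * Δ * a₂ := by ring
    exact ⟨le_trans (by exact_mod_cast h1) hab, fun _ => le_trans haa₂R ha₂dΔ,
      Or.inl ⟨hQ₂𝔮, le_trans (by exact_mod_cast h3) hab⟩⟩
  · -- `Q₂ ∉ (Q)`: Bézout for the pair `(Q, Q₂)` on `𝔮'` (and on `𝔮` if `Q₂ ∈ 𝔮`), else Bézout
    -- on the curve `𝔮` cut by `Q₂ ∈ 𝔮' ⊆ 𝔭`
    have haa₂ : ((a * a₂ : ℕ) : ℝ) ≤ 2 * Δ * a₂ := by
      push_cast
      have h0 : (0 : ℝ) ≤ Δ * a₂ := mul_nonneg (by linarith) (by positivity)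
      calc (a : ℝ) * a₂ ≤ Δ * a₂ := mul_le_mul_of_nonneg_right haΔ (by positivity)
        _ ≤ 2 * Δ * a₂ := by linarith
    have h1 : ideg 𝔮' 2 ≤ a * a₂ :=
      ideg_le_mul_of_rankTwo Q Q₂ a a₂ hQ0 hQhom hQ₂hom ha1 ha₂1 hQprime hQQ₂ 𝔮' h𝔮'p h𝔮'h h𝔮'u
        hQ𝔮' hQ₂𝔮'
    refine ⟨le_trans (by exact_mod_cast h1) haa₂, fun h => absurd h hQQ₂, ?_⟩
    by_cases hQ₂𝔮 : Q₂ ∈ 𝔮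
    · have h3 : ideg 𝔮 2 ≤ a * a₂ :=
        ideg_le_mul_of_rankTwo Q Q₂ a a₂ hQ0 hQhom hQ₂hom ha1 ha₂1 hQprime hQQ₂ 𝔮 h𝔮p h𝔮h h𝔮u
          hQ𝔮 hQ₂𝔮
      exact Or.inl ⟨hQ₂𝔮, le_trans (by exact_mod_cast h3) haa₂⟩
    · exact Or.inr ⟨hQ₂𝔮, ideg_le_mul_of_rankOne 𝔮 Q₂ a₂ h𝔮p h𝔮h h𝔮u hQ₂hom ha₂1 hQ₂𝔮 𝔭 h𝔭p
        h𝔭h h𝔭u h𝔮𝔭 (h𝔮'𝔭 hQ₂𝔮')⟩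

end Summit.Schanuel.Schanuel.Cruxes.ApproximationProperty.OrbitInterpolationDeterminant

end
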